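import Summits.HodgeConjecture.HodgeConjecture.Theorems.HCCMUnconditionalOfGenericFloorV7
import Summits.HodgeConjecture.CorCM.Hyp413.A3Liu413FaceTypes
import Summits.HodgeConjecture.HodgeConjecture.Theorems.H413CohFormsCarriers
import Summits.HodgeConjecture.HodgeConjecture.Theorems.H413MatsushimaHodgeClassMap
import Mathlib.RepresentationTheory.Intertwining
import HarnessLib

/-!
# FLOOR-0 PROGRAMME P4 «admissible occurs in H¹» — LINE `P4AdmissibleOccursInH1` (the THETA ROAD at the pin), skeleton v1

Cell hodgecm-mathlib (D-0151), human ruling D-0183 / director s317 (FLOOR 0 = HC_CM on Mathlib alone); crux item H413 =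
stmt-HodgeConjecture-24833 (route `HCCMUnconditional`).  TARGET = the `hocc` binder of ★ `Theorems/HCCMUnconditionalOfGenericFloorV7.lean`
ll. 81–86 VERBATIM (= the registered stub `stub_admissible_occursInH1` of `Cruxes/H413/Lines/a3_liu413.lean` v10.2 0227045a, ll. 310–314;
letter `Literature.NumberTheory.GelbartRogawski1991.admissible_occursInH1`): at `n = 3`, for every embedding `τ'` and every adèlic
oscillator triple `t = (μ, ε, χ)` of the PIN's datum `P(F, V, a₀, Φ, i)` (`datum413`, ★ `CorCM/Hyp413/A3Liu413FaceTypes`) with `μ` of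
weight one and `ε` `μ`-admissible, `ω_V(t) = ⊗'_v ω(μ_v, ε_v, χ_v)` (the tree's CONSTRUCTED `Def411WeilCarriers.rhoAtLine` on the line of
record) OCCURS in the PIN's `H¹_{B,τ'}(A_∞, ℂ)` (the CONSTRUCTED tower module of `H¹(P_Γ(V); ℂ)`, `LiuDictionaryPin`): there is a
non-zero `ℂ[U(V)(𝔸_{F⁺,f})]`-intertwiner `ω_V(t) → H¹_B`.

IDEA («why this line»).  This is [Liu2021, proof of Prop. 4.13, l. 2145] «Conversely, for every such adèlic oscillator triple `(μ,ε,χ)`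
there exists a pair `(W, π_W)` … `Θ^V_{(μ,ν),W}(π_W)` is contained in `L²_disc(G)`, `ω(μ,ε,χ) ≅ π^∞` and `H¹(𝔤, K_G; π_∞) ≠ 0`» read at the pin
in the language the tree ALREADY has for `U(V)`: the GLOBAL THETA LIFT of the character `χ` of `U(W_ε) = E¹` to `U(V)` produces, for the
HARMONIC archimedean test vector of cotangent `K_∞`-type (which exists exactly when `μ` has weight one and `ε` is `μ`-admissible —
[Liu2021, Lem. D.2 (2)] ⟸ [KonnoKonno2007, Thm. 5.4]), HOLOMORPHIC (resp. anti-holomorphic) COTANGENT-WEIGHT AUTOMORPHIC FORMS on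
`U(V)(F⁺)\U(V)(𝔸_{F⁺})` — i.e. `(1,0)`- (resp. `(0,1)`-) forms on the ball quotients `P_Γ(V) = Γ\𝔹²` of all levels ([Borel1997, §5.14] dictionary,
★ `UnitaryBallClassMap`) — depending `U(V)(𝔸_{F⁺,f})`-equivariantly on the finite test function and descending to the `χ`-coinvariants
`ω_V(t)`; the lift is NON-ZERO (Rallis inner product formula in the stable range `1 < 3/2`, [Li1992, Thm. 2.1]; at `n = 3` also
[GelbartRogawski1991, Thm. 5.1.1]); and a non-zero holomorphic `1`-form has a non-zero class in `H¹(P_Γ; ℂ)` (Hodge theory on the compact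
Kähler surface `P_Γ`, [VoisinHodgeI2002, Cor. 7.6]; ★ `classMapDatumOf_pull_injective`/`descends` at each level), `U(V)(𝔸_{F⁺,f})`-equivariantly
in the tower (Matsushima–Murakami / [BorelWallach2000, VII 3.2, 3.6; XIII 1.2]).  No trace formula, no A-packet and no Vogan–Zuckerman
classification is used in this direction (those are the `(⇒)`/multiplicity inputs of rows III-2 (a)′ ∕ III-J3a, programmes P2/P3).

THE MIDDLE OBJECTS ARE CONCRETE.  Everything is stated over EXISTING declarations: the adelic group datum
`𝒢(V) := UnitaryGroup.adelicGroupData F⁺ K c̄ 3 (Hm V)` (★ `Automorphic/UnitaryGroupAutomorphicRep`) — whose finite-adelic points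
`UnitaryGroup.finAdelic … (Hm V)` ARE the pin's group `P.G = ↥V.adelicFin` (`HodgeCM/CM/Basic`, same declaration) with
`UnitaryGroup.finAdelicToAdelic` (★ `UnitaryGroupRestrictedProduct`) and archimedean points `UnitaryGroup.arch`/`archToAdelic`
(★ `UnitaryGroupArchimedean`); `ℂ²`-valued functions on `𝒢(V).Adelic` with the generic weight-form space `weightForms`
(★ `Automorphic/WeightForms`) for the cotangent isotropy representation `weightOf x₀` of `Stab_{U(2,1)}(x₀)` (★ `BallForms.cotangentCocycle`,
★ `AutomorphyFactorForms`), holomorphic germs along an archimedean restriction `U(2,1) →* 𝒢(V).Adelic` (★ `HodgeCM.Model.IsHolGerm`/`holGerms`,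
generic in the ambient group) — these carriers live in the shared tree file `Theorems/H413CohFormsCarriers.lean` (sorry-free,
ns `…Cruxes.H413.CohFormsCarriers`; also read by P2's line).  The ONE hypothesis structure of the line (brief §3) is `ArchFactor F V` — the archimedean factorisation
`U(V)(𝔸_{F⁺}) = U(2,1) · K_c · U(V)(𝔸_{F⁺,f})` (DATA: `ιinf : U(2,1) →* 𝒢(V).Adelic` at the indefinite place `ι₁`, `Kc` = the product of the
compact `U(3)`'s at the other real places), pinned by the definitional predicate `ArchFactor.IsHonest` (commutation, injectivity,
product decomposition, range = `range archToAdelic`).  v2 («AT THE FACTOR OF RECORD»): the stubs speak about ONE factor, the carriers' §3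
`archFactorOf F V` — `ιinf` = ★ `UnitaryGroup.archSectionU21CM … V.sylvesterFrame …`, i.e. the tower's own `HodgeCM.Model.archInfOf V` read in
this currency (`toLatticeModelG V ∘ ιinf = archInfOf V`, ★ `archInfOf_apply`), `K_c = (ker archProjU21EmbCM).map archToAdelic` — whose HONESTY is the
theorem `P4StubT1ArchFactor.archFactorOf_isHonest` (`Theorems/P4StubT1ArchFactor.lean`, kernel, trio; v1's T1), so no `∀ 𝔞`/`IsHonest →`
binder remains: v1's universally quantified T2/T3 were strictly HARDER than the mathematics (an honest `𝔞` is pinned by `IsHonest` only up to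
e.g. discontinuous central twists of `U(2,1)`, which no tree tool relates to `archInfOf V`), for no gain in the composition.

STUBS (the two registered proof holes; v0 RE-CUT of FLOOR0-PLAN v1 §1 P4 «T1 Matsushima · T2 VZ · T3 arch theta · T4 global θ ≠ 0 · T5 assembly» along the
seams the `(⇐)` direction actually has — see the line card `P4AdmissibleOccursInH1.md` §Stubs for the dictionary and the promote candidates):
* (v1's `stub_T1_archFactor` (S) is a THEOREM: `archFactorOf_isHonest` / `stubT1ArchFactor_holds`, `Theorems/P4StubT1ArchFactor.lean`.)
* `stub_T2_matsushimaHodgeAt` (M–L) — at `𝔞₀ = archFactorOf F V`, for every `τ'`, there is an INJECTIVE `U(V)(𝔸_{F⁺,f})`-equivariant `ℂ`-linear CLASS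
  MAP from the smooth (anti)holomorphic cotangent automorphic forms `cohForms 𝔞₀` into the pin's `H¹_{B,τ'}(A_∞, ℂ)` (FLOOR0-PLAN T1 + T5a + the
  `(1,0)/(0,1)` half of T2: [BorelWallach2000, VII 3.2 / 3.6 (Matsushima, Hodge bigrading); XIII 1.2 (adelic pieces)], [VoisinHodgeI2002, Cor. 7.6];
  levelwise ★ `Model.classMapDatumOf` (`descends`, `pull_injective`), tower glue = TRANSPORT of the theta instance's ★ `compAt`/`compClass`/
  `towerFamily_mem`/`towerFamily_adelicThetaRepFin_eq_translate`/`towerFamily_eq_restrictLevel`/`res_towerFamily` to general cuspidal cotangent forms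
  along `toLatticeModelG V` — possible exactly because `𝔞₀.ιinf` is `archInfOf V`).
* `stub_T3_thetaFormsAt` (L–XL; FLOOR0-PLAN T3 + T4, to be promoted/split once the adèlic Weil representation of the pair `(U(V), U(W_t))` at the
  pin is a typed carrier — shared with P2-U2∕U3∕U4) — at `𝔞₀`, at `n = 3`, for every weight-one admissible `t`: a NON-ZERO
  `U(V)(𝔸_{F⁺,f})`-equivariant `ℂ`-linear map `θ_t : ω_V(t) → (𝒢(V).Adelic → ℂ²)` with values in `cohForms 𝔞₀` (the finite part of the global theta
  lift with harmonic archimedean vector: [Weil1964, n° 41 Thm. 6] automorphy, [GelbartRogawski1991, §3 Prop. 3.1.1] splitting∕equivariance,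
  [Liu2021, Lem. D.2 (2)] ⟸ [KonnoKonno2007, Thm. 5.4] archimedean type, [Liu2021, Lem. D.2 (1)] triviality at the definite places,
  [Li1992, Thm. 2.1] (Rallis inner product, stable range) non-vanishing).
KERNEL-CHECKED (no hole): `occursInH1_of_classMap_of_thetaForms` (the algebra: injective ∘ non-zero equivariant = non-zero intertwiner),
`admissible_occursInH1_holds_of : StubT2 → StubT3 → HoccType`, `hocc_of_stubs : HoccType` (HEAD 1 at the two stub theorems — the by-name fold
`stub_admissible_occursInH1 := hocc_of_stubs` of `a3_liu413` v10.2 once T2–T3 are theorems), and the head of record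
`H413_of_P4 : StubT2 → StubT3 → HdictEType → HJ3aType → …Theses.HCCMUnconditional.H413` (via ★ `Hyp413Closing.H413_of_three_facts_flat`; the
other two floor rows as hypotheses, NOT re-declared — A-plan1 (g17) 19:12:10Z).  Registered holes = EXACTLY {`stub_T2_matsushimaHodgeAt`, `stub_T3_thetaFormsAt`}.
Barriers: none catalogued for HodgeConjecture in the representation-theory class (`Literature/Barriers/HodgeConjecture/` has no theta∕Matsushima
entry) — said so in the card.  Dead line avoided: the `(⇒)` direction «occurs ⇒ admissible» ∕ `muAdmissible_iff_multiplicity_one` is NOT claimed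
(false on non-global `ε`, edition E-III2; REF1 2026-08-28T12:49:36Z).

HC_CM is proved only modulo the 7 printed citations until rung 0 closes; this file proves NOTHING about them — it fixes the decomposition of ONE
of the five FLOOR-0 binders (`hocc`) into two named lemmas (+ one landed theorem) over existing declarations and checks the composition in the kernel.

## References
* [Liu2021] Y. Liu, *Fourier–Jacobi cycles and arithmetic relative trace formula*, Camb. J. Math. 9 (2021) = arXiv:2102.11518 — Prop. 4.13 and
  its proof (FJcycle.tex ll. 2113–2146, esp. l. 2145 «Conversely …»), Def. 4.11–4.12, App. D Lem. D.2 (ll. 5279–5289).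
* [GelbartRogawski1991] S. Gelbart, J. Rogawski, Invent. Math. 105 (1991) — §3 (pp. 455–461), Prop. 3.1.1, Thm. 5.1.1 (p. 465).
* [Li1992] J.-S. Li, *Non-vanishing theorems for the cohomology of certain arithmetic quotients*, J. reine angew. Math. 428 (1992), Thm. 2.1
  (Rallis inner product formula), §5.  [Rallis1984] S. Rallis, *Injectivity properties of liftings associated to Weil representations*,
  Compositio Math. 52 (1984).
* [Weil1964] A. Weil, *Sur certains groupes d'opérateurs unitaires*, Acta Math. 111 (1964), n° 37–41 (Thm. 6).
* [KonnoKonno2007] T. Konno, K. Konno, Kyushu J. Math. 61 (2007), Thm. 5.4.  [BergeronMillsonMoeglin2016Balls] Acta Math. 216 (2016), §5.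
* [BorelWallach2000] A. Borel, N. Wallach, Math. Surveys Monogr. 67 (2000), VII 2.10, 3.2, 3.4, 3.6 (Matsushima), XIII 1.2, 2.4.
* [MatsushimaMurakami1963] Y. Matsushima, S. Murakami, Ann. of Math. 78 (1963).  [VoisinHodgeI2002] C. Voisin, Hodge Theory I, Cor. 7.6.
* [Borel1997] A. Borel, *Automorphic forms on SL₂(ℝ)*, §5.14.  [PlatonovRapinchuk1994] V. Platonov, A. Rapinchuk, §5.1.
* Tree: ★ `Theorems/HCCMUnconditionalOfGenericFloorV7` (p756419), ★ `CorCM/Hyp413/A3Liu413FaceTypes` (`datum413`), ★ `Theorems/HCCMUnconditionalH413OfFacts`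
  (`Hyp413Closing.H413_of_three_facts_flat`), ★ `GelbartRogawski1991/OscillatorTripleExistenceAndOccurrence` + `OscillatorTripleDictionary`
  (`admissible_occursInH1`, `OccursInH1`, `rhoTriple`), ★ `Automorphic/UnitaryGroupAutomorphicRep` + `UnitaryGroupRestrictedProduct` +
  `UnitaryGroupArchimedean`, ★ `Automorphic/WeightForms`, ★ `ShimuraVarieties/UnitaryBallAutomorphicForms`, ★ `HodgeCM/Model/ThetaHolGerm`.
-/

set_option autoImplicit false

-- the mandated namespace has the single-problem summit's repeated segment (`HodgeConjecture.HodgeConjecture`), as in every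
-- `Cruxes/…/Lines/*.lean` and `Theorems/*.lean` of this sub-problem
set_option linter.dupNamespace false

noncomputable section

namespace Summit.HodgeConjecture.HodgeConjecture.Cruxes.H413.P4AdmissibleOccursInH1

open scoped TensorProduct Matrix
open NumberField NumberField.InfinitePlace IsDedekindDomain
open HodgeCM.Model HodgeCM.Model.LiuIndex HodgeCM.Model.TowerCarrier
open Summit.HodgeConjecture.CorCM.Model
open Literature.AlgebraicGeometry.Motives (CMType AbelianVariety)
open Literature.AlgebraicGeometry.HodgeTheory Literature.NumberTheory.Automorphic.PicardCM
open Literature.AlgebraicGeometry.ShimuraVarieties Literature.AlgebraicGeometry.ShimuraVarieties.UnitaryCanonicalModel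
open Literature.NumberTheory.ComplexMultiplication
open Literature.NumberTheory.Automorphic
open Literature.NumberTheory.Automorphic.Liu2021 Literature.NumberTheory.Automorphic.Liu2021.AppendixC
open Literature.NumberTheory.Automorphic.Liu2021.Def411WeilCarriers (lineOf locF Rep)
open Summit.HodgeConjecture.CorCM.Transposition.OmegaTransport (realUnit)
open HodgeCM.Model.ArchSideTerm (e₁)
open Literature.NumberTheory.GelbartRogawski1991 Literature.NumberTheory.GelbartRogawski1991.UnitaryDualPair
open Literature.RepresentationTheory Literature.RepresentationTheory.Liu2021
open Summit.HodgeConjecture.CorCM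
open Summit.HodgeConjecture.CorCM.Transposition
open Literature.NumberTheory.GelbartRogawski1991.OscillatorTripleDictionary (OccursInH1 IsIsoToOmega)
open Summit.HodgeConjecture.CorCM.Lines.A3Liu418 (Thm415AtFace EpsRigidAtFace)
open Summit.HodgeConjecture.HodgeConjecture.Theses (HCCMUnconditional.HDel)
open MulAction
open Literature.Geometry.ComplexHyperbolic.BallModel (U21 x₀)
open Literature.NumberTheory.GelbartRogawski1991.OscillatorTripleDictionary (rhoTriple)
open Summit.HodgeConjecture.CorCM.Lines.A3Liu413 (datum413)

/-! ## §0 The three binder types of the floor, VERBATIM (floor V7 ll. 71–85; brief §1) -/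

set_option synthInstance.maxHeartbeats 400000 in
set_option maxHeartbeats 8000000 in
/-- **`HoccType`** — the TYPE of the `hocc` binder of ★ `hc_cm_of_generic_floor_v7` (ll. 81–85), token-for-token = the registered stub
`stub_admissible_occursInH1` of `Cruxes/H413/Lines/a3_liu413.lean` v10.2: row III-2 (c)′, the OCCURRENCE direction of
[Liu2021, proof of Prop. 4.13, l. 2145] at admissible weight-one triples of the pin's datum. [cite: Liu2021, proof of Prop. 4.13, l. 2145]
[cite: GelbartRogawski1991, Thm 5.1.1 p. 465] [cite: Li1992, Thm. 2.1] -/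
def HoccType : Prop :=
  ∀ (hDel : Literature.AlgebraicGeometry.ShimuraVarieties.UnitaryCanonicalModel.canonicalModel_exists_printed)
    (F : HodgeCM.CMField) [IsGalois ℚ F] (h6 : 6 ≤ Module.finrank ℚ F) {ι₁ : F →+* ℂ} (V : HodgeCM.HermSpace3 F ι₁) (a₀ : RealScalar F)
    (Φ : CMType F) (hΦ : ι₁ ∈ Φ.1) (i : (I V (repAt a₀) (muLiu ι₁ GramClass.rep))),
    admissible_occursInH1 (((uniformOmegaRep (Summit.HodgeConjecture.CorCM.DelRec.exists_recordSystem_of_printed hDel) ⟨HodgeCM.CMField.K F⟩ ι₁ ⟨HodgeCM.HermSpace3.Hm V, HodgeCM.HermSpace3.isHermitian V, HodgeCM.HermSpace3.signature_ι₁ V, HodgeCM.HermSpace3.posDef_of_ne V⟩ Φ e₁ (frameD V) (frameD_real V) (frameD_ne V) (ιVE V) (2 * imagUnit (HodgeCM.CMField.K F))⁻¹ (fun _ _ => (Rep.update ↥(maximalRealSubfield (HodgeCM.CMField.K F)) (imagUnitSq (HodgeCM.CMField.K F)) (Rep.ofLineOf ↥(maximalRealSubfield (HodgeCM.CMField.K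 F)) (imagUnitSq (HodgeCM.CMField.K F))) (locF ↥(maximalRealSubfield (HodgeCM.CMField.K F)) (imagUnitSq (HodgeCM.CMField.K F)) (realUnit ⟨HodgeCM.CMField.K F⟩ (repAt a₀ (Sigma.fst i)).1 (repAt a₀ (Sigma.fst i)).2.1 (repAt a₀ (Sigma.fst i)).2.2)) (realUnit ⟨HodgeCM.CMField.K F⟩ (repAt a₀ (Sigma.fst i)).1 (repAt a₀ (Sigma.fst i)).2.1 (repAt a₀ (Sigma.fst i)).2.2) rfl)))).prop413Data ((liuDictionaryPin exists_isReal_hodgeModel_holds hodgePQ_independent_of_hodgeModel_holds BallQuotient.ballQuotientUniformised_holds (cmAbelianVarietyRealised_of_eigenbasis exists_isReal_hodgeModel_holds hodgePQ_independent_of_hodgeModel_holds cmAbelianVarietyEigenbasisRealised_holds) Literature.NumberTheory.Transcendental.arapura2012_cor_15_4_6_holds V (I V (repAt a₀) (muLiu ι₁ GramClass.rep)) (line V (repAt a₀) (muLiu ι₁ GramClass.rep)))).H)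

set_option synthInstance.maxHeartbeats 400000 in
set_option maxHeartbeats 8000000 in
/-- **`HdictEType`** — the TYPE of the `hdictE` binder of ★ `hc_cm_of_generic_floor_v7` (ll. 71–75), row III-2 (a)′ (existence half of the
oscillator-triple dictionary), VERBATIM; programme P2's target, an INPUT of the second head only. [cite: Liu2021, proof of Prop. 4.13, l. 2145]
[cite: GelbartRogawski1991, Introduction p. 448; Thm 5.1.1 p. 465] -/
def HdictEType : Prop :=
  ∀ (hDel : Literature.AlgebraicGeometry.ShimuraVarieties.UnitaryCanonicalModel.canonicalModel_exists_printed)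
    (F : HodgeCM.CMField) [IsGalois ℚ F] (h6 : 6 ≤ Module.finrank ℚ F) {ι₁ : F →+* ℂ} (V : HodgeCM.HermSpace3 F ι₁) (a₀ : RealScalar F)
    (Φ : CMType F) (hΦ : ι₁ ∈ Φ.1) (i : (I V (repAt a₀) (muLiu ι₁ GramClass.rep))),
    oscillatorTriple_dictionaryExistence (((uniformOmegaRep (Summit.HodgeConjecture.CorCM.DelRec.exists_recordSystem_of_printed hDel) ⟨HodgeCM.CMField.K F⟩ ι₁ ⟨HodgeCM.HermSpace3.Hm V, HodgeCM.HermSpace3.isHermitian V, HodgeCM.HermSpace3.signature_ι₁ V, HodgeCM.HermSpace3.posDef_of_ne V⟩ Φ e₁ (frameD V) (frameD_real V) (frameD_ne V) (ιVE V) (2 * imagUnit (HodgeCM.CMField.K F))⁻¹ (fun _ _ => (Rep.update ↥(maximalRealSubfield (HodgeCM.CMField.K F)) (imagUnitSq (HodgeCM.CMField.K F)) (Rep.ofLineOf ↥(maximalRealSubfield (HodgeCM.CMField.K F)) (imagUnitSq (HodgeCM.CMField.K F))) (locF ↥(maximalRealSubfield (HodgeCM.CMField.K F)) (imagUnitSq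 (HodgeCM.CMField.K F)) (realUnit ⟨HodgeCM.CMField.K F⟩ (repAt a₀ (Sigma.fst i)).1 (repAt a₀ (Sigma.fst i)).2.1 (repAt a₀ (Sigma.fst i)).2.2)) (realUnit ⟨HodgeCM.CMField.K F⟩ (repAt a₀ (Sigma.fst i)).1 (repAt a₀ (Sigma.fst i)).2.1 (repAt a₀ (Sigma.fst i)).2.2) rfl)))).prop413Data ((liuDictionaryPin exists_isReal_hodgeModel_holds hodgePQ_independent_of_hodgeModel_holds BallQuotient.ballQuotientUniformised_holds (cmAbelianVarietyRealised_of_eigenbasis exists_isReal_hodgeModel_holds hodgePQ_independent_of_hodgeModel_holds cmAbelianVarietyEigenbasisRealised_holds) Literature.NumberTheory.Transcendental.arapura2012_cor_15_4_6_holds V (I V (repAt a₀) (muLiu ι₁ GramClass.rep)) (line V (repAt a₀) (muLiu ι₁ GramClass.rep)))).H)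

set_option synthInstance.maxHeartbeats 400000 in
set_option maxHeartbeats 8000000 in
/-- **`HJ3aType`** — the TYPE of the `hJ3a` binder of ★ `hc_cm_of_generic_floor_v7` (ll. 76–80), row III-J3a (multiplicity `≤ 1`), VERBATIM;
programme P3's target, an INPUT of the second head only. [cite: Liu2021, proof of Prop. 4.13, l. 2145] [cite: Rogawski1990, Thm. 13.3.1] -/
def HJ3aType : Prop :=
  ∀ (hDel : Literature.AlgebraicGeometry.ShimuraVarieties.UnitaryCanonicalModel.canonicalModel_exists_printed)
    (F : HodgeCM.CMField) [IsGalois ℚ F] (h6 : 6 ≤ Module.finrank ℚ F) {ι₁ : F →+* ℂ} (V : HodgeCM.HermSpace3 F ι₁) (a₀ : RealScalar F)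
    (Φ : CMType F) (hΦ : ι₁ ∈ Φ.1) (i : (I V (repAt a₀) (muLiu ι₁ GramClass.rep))),
    (((uniformOmegaRep (Summit.HodgeConjecture.CorCM.DelRec.exists_recordSystem_of_printed hDel) ⟨HodgeCM.CMField.K F⟩ ι₁ ⟨HodgeCM.HermSpace3.Hm V, HodgeCM.HermSpace3.isHermitian V, HodgeCM.HermSpace3.signature_ι₁ V, HodgeCM.HermSpace3.posDef_of_ne V⟩ Φ e₁ (frameD V) (frameD_real V) (frameD_ne V) (ιVE V) (2 * imagUnit (HodgeCM.CMField.K F))⁻¹ (fun _ _ => (Rep.update ↥(maximalRealSubfield (HodgeCM.CMField.K F)) (imagUnitSq (HodgeCM.CMField.K F)) (Rep.ofLineOf ↥(maximalRealSubfield (HodgeCM.CMField.K F)) (imagUnitSq (HodgeCM.CMField.K F))) (locF ↥(maximalRealSubfield (HodgeCM.CMField.K F)) (imagUnitSq (HodgeCM.CMField.K F)) (realUnit ⟨HodgeCM.CMField.K F⟩ (repAt a₀ (Sigma.fst i)).1 (repAt a₀ (Sigma.fst i)).2.1 (repAt a₀ (Sigma.fst i)).2.2)) (realUnit ⟨HodgeCM.CMField.K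 F⟩ (repAt a₀ (Sigma.fst i)).1 (repAt a₀ (Sigma.fst i)).2.1 (repAt a₀ (Sigma.fst i)).2.2) rfl)))).prop413Data ((liuDictionaryPin exists_isReal_hodgeModel_holds hodgePQ_independent_of_hodgeModel_holds BallQuotient.ballQuotientUniformised_holds (cmAbelianVarietyRealised_of_eigenbasis exists_isReal_hodgeModel_holds hodgePQ_independent_of_hodgeModel_holds cmAbelianVarietyEigenbasisRealised_holds) Literature.NumberTheory.Transcendental.arapura2012_cor_15_4_6_holds V (I V (repAt a₀) (muLiu ι₁ GramClass.rep)) (line V (repAt a₀) (muLiu ι₁ GramClass.rep)))).H).multiplicity_le_one_printed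

/-! ## §1–§2 The carriers — IN THE TREE BY NAME: `Theorems/H413CohFormsCarriers.lean` (shared with P2; A-plan1 (g17) 19:07:55Z/19:35:25Z)
`adelicDatum`, `finToAdelic`, `archToAdelic'`, `ArchFactor` + `ArchFactor.IsHonest`, `rightRep`, `smoothFun`, `conjFun`, `holCotForms`, `cohForms`
(ns `Summit.HodgeConjecture.HodgeConjecture.Cruxes.H413.CohFormsCarriers`, opened below). -/

open Summit.HodgeConjecture.HodgeConjecture.Cruxes.H413.CohFormsCarriers

/-! ## §3 The two registered P4 stubs (v2: AT THE FACTOR OF RECORD `archFactorOf F V`) -/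

/-! ### T1 is NOT a stub any more (v2): the archimedean factor of record `archFactorOf F V` (carriers §3) is HONEST by the THEOREM
`…Cruxes.H413.P4StubT1ArchFactor.archFactorOf_isHonest` (`Theorems/P4StubT1ArchFactor.lean`, kernel, trio) — the object-match certificate that
T2′/T3′ below speak about the factorisation `U(V)(𝔸_{F⁺}) = U(2,1) · K_c · U(V)(𝔸_{F⁺,f})` whose `U(2,1)` IS the tower's `archInfOf V`. -/

set_option synthInstance.maxHeartbeats 400000 in
set_option maxHeartbeats 8000000 in
/-- STUB TYPE **T2 — MATSUSHIMA–HODGE CLASS MAP AT THE PIN** (M–L; FLOOR0-PLAN T1 + T5a + the Hodge-type half of T2): for every face and every `τ'`,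
at THE archimedean factor of record `𝔞₀ = archFactorOf F V` (carriers §3), there is a `ℂ`-linear CLASS MAP `cls : cohForms 𝔞₀ → H¹_{B,τ'}(A_∞, ℂ)` into the PIN's tower module
(`(datum413 …).HB τ'` with its `ℂ[U(V)(𝔸_{F⁺,f})]`-action `rhoB τ'`) which is INJECTIVE and `U(V)(𝔸_{F⁺,f})`-EQUIVARIANT for right
translation.  Content: at each level `Γ`, a (anti)holomorphic cotangent form of level `Γ.K` IS a `(1,0)`/`(0,1)`-form on `P_Γ(V) = Γ\𝔹²`
([Borel1997, §5.14]; ★ `Model.classMapDatumOf`: `descends`, `pull_injective`) whose de Rham class is non-zero when the form is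
(Hodge theory on the compact Kähler surface `P_Γ`, [VoisinHodgeI2002, Cor. 7.6]; ★ `F¹H¹`); the classes are compatible with pull-back and
Hecke translation in the tower (Matsushima–Murakami functoriality, [BorelWallach2000, VII 3.2, 3.6; XIII 1.2]; binder-1 `ofLevel`/`towerFamily`,
sinst-1 `of_smul_clsAt` for the theta instance), hence assemble to an injective equivariant map into `H = colim_K H¹`.  Why it might fail:
the pin's `H` is the tower of the IDENTITY components `P_Γ`; a form of level `K` has classes on every component `X_K = ∐ P_{Γ_h}` —
the tower is built exactly as `colim_K ⊕_h H¹(P_{Γ_h})` (`LiuDictionary` docstring (α4)), so injectivity holds; if a reviewer reads `H`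
otherwise, restrict `cls` to forms supported on the identity double coset (reshaping, not failure).
[cite: BorelWallach2000, VII 3.2, VII 3.6, XIII 1.2] [cite: VoisinHodgeI2002, Cor. 7.6] [cite: Borel1997, §5.14] [cite: MatsushimaMurakami1963, §4] -/
def StubT2MatsushimaHodgeAt : Prop :=
  ∀ (hDel : Literature.AlgebraicGeometry.ShimuraVarieties.UnitaryCanonicalModel.canonicalModel_exists_printed)
      (F : HodgeCM.CMField) [IsGalois ℚ F] (h6 : 6 ≤ Module.finrank ℚ F) {ι₁ : F →+* ℂ} (V : HodgeCM.HermSpace3 F ι₁) (a₀ : RealScalar F)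
      (Φ : CMType F) (hΦ : ι₁ ∈ Φ.1) (i : (I V (repAt a₀) (muLiu ι₁ GramClass.rep))),
      3 ≤ (datum413 hDel F V a₀ Φ i).n → ∀ τ' : HodgeCM.CMField.K F →+* ℂ,
        ∃ cls : ↥(cohForms (archFactorOf F V)) →ₗ[ℂ] (datum413 hDel F V a₀ Φ i).HB τ',
          Function.Injective cls ∧
            ∀ (g : ↥(HodgeCM.HermSpace3.adelicFin V)) (f : ↥(cohForms (archFactorOf F V)))
              (hgf : rightRep F V g (f : _) ∈ cohForms (archFactorOf F V)),
              cls ⟨rightRep F V g (f : _), hgf⟩ = (datum413 hDel F V a₀ Φ i).rhoB τ' g (cls f)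

set_option synthInstance.maxHeartbeats 400000 in
set_option maxHeartbeats 8000000 in
/-- STUB TYPE **T3 — THE GLOBAL THETA LIFT PRODUCES NON-ZERO COHOMOLOGICAL COTANGENT FORMS OUT OF `ω_V(t)`** (L–XL; FLOOR0-PLAN T3 + T4;
Liu's «Conversely …» sentence minus cohomology): for every face, at `n = 3`, at the factor of record `𝔞₀ = archFactorOf F V`, and every triple `t = (μ, ε, χ)` of the pin
with `μ` OF WEIGHT ONE and `ε` `μ`-ADMISSIBLE, there is a `ℂ`-linear map `θ : ω_V(t) → (U(V)(𝔸_{F⁺}) → ℂ²)` which is NON-ZERO,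
`U(V)(𝔸_{F⁺,f})`-EQUIVARIANT (`θ (ω_V(t)(g) v) = R_g (θ v)`) and takes values in `cohForms 𝔞₀`.  Content: `θ(Φ_f) := Θ(φ_∞^{harm} ⊗ Φ_f)` the
theta kernel of the dual pair `(U(W_t), U(V))`, `W_t` the hermitian LINE of record of the class `ε` (the pin's `Rep.update … (realUnit …)`),
with splitting character `μ` ([GelbartRogawski1991, §3 Prop. 3.1.1]; [Weil1964, n° 41 Thm. 6]: automorphy = left `U(V)(F⁺)`-invariance,
continuity ⇒ smoothness), integrated against `χ` on the compact `[U(W_t)]` — it is `χ`-covariant hence factors through the `χ`-coinvariants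
`ω_V(t) = ⊗'_v ω(μ_v, ε_v, χ_v)` (the tree's `rhoAtLine` IS that coinvariant quotient: `TwistedCoinv`); the archimedean vector `φ_∞^{harm}` of
`K_∞`-type `(weightOf x₀)^∨` annihilated by `𝔭⁻` EXISTS in `ω(μ_{ι₁}, ε_{ι₁}, χ_{ι₁})` iff `μ` has weight one and `ε` is `μ`-admissible with the
sign read at `ι₁` ([Liu2021, Lem. D.2 (2)] ⟸ [KonnoKonno2007, Thm. 5.4]; the other sign gives the conjugate type, whence `cohForms` and not
`holCotForms`), the Gaussian at the definite places is `K_c`-fixed ([Liu2021, Lem. D.2 (1)]); NON-VANISHING of the lift = Rallis inner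
product formula in the stable range `dim W = 1 < 3/2` ([Li1992, Thm. 2.1]; [Rallis1984]).  Promote/split candidates (card §Stubs): T3a theta
kernel + descent, T3b archimedean harmonic vector, T3c Rallis — once the adèlic Weil representation of the pair at the pin is a typed carrier
(P2-U2/U3 share it).  Why it might fail: as printed it cannot (l. 2145); at the pin only through the identification of the tree's `rhoAtLine`
with Liu's `ω(μ,ε,χ)` on the line of record — which is what rows hD1″/h411 already certified (`Def411WeilCarriers*`).
[cite: Liu2021, proof of Prop. 4.13, l. 2145; App. D Lem. D.2 (1)(2)] [cite: GelbartRogawski1991, §3 Prop. 3.1.1 (p. 455); Thm 5.1.1 (p. 465)]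
[cite: Weil1964, n° 41 Thm. 6] [cite: Li1992, Thm. 2.1] [cite: KonnoKonno2007, Thm. 5.4] -/
def StubT3ThetaFormsAt : Prop :=
  ∀ (hDel : Literature.AlgebraicGeometry.ShimuraVarieties.UnitaryCanonicalModel.canonicalModel_exists_printed)
      (F : HodgeCM.CMField) [IsGalois ℚ F] (h6 : 6 ≤ Module.finrank ℚ F) {ι₁ : F →+* ℂ} (V : HodgeCM.HermSpace3 F ι₁) (a₀ : RealScalar F)
      (Φ : CMType F) (hΦ : ι₁ ∈ Φ.1) (i : (I V (repAt a₀) (muLiu ι₁ GramClass.rep))),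
      (datum413 hDel F V a₀ Φ i).n = 3 →
        ∀ (t : (datum413 hDel F V a₀ Φ i).Triple), t.HasWeightOne → t.IsAdmissible →
          ∃ θ : (datum413 hDel F V a₀ Φ i).omega t.μ t.isConjugateSymplectic t.ε t.χ →ₗ[ℂ]
              ((adelicDatum F V).Adelic → (Fin 2 → ℂ)),
            θ ≠ 0 ∧ (∀ v, θ v ∈ cohForms (archFactorOf F V)) ∧
              ∀ (g : ↥(HodgeCM.HermSpace3.adelicFin V)) (v : (datum413 hDel F V a₀ Φ i).omega t.μ t.isConjugateSymplectic t.ε t.χ),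
                θ (rhoTriple (datum413 hDel F V a₀ Φ i) t g v) = rightRep F V g (θ v)

/-- **`stub_T2_matsushimaHodgeAt`** — REGISTERED STUB T2 (M–L): the injective equivariant Matsushima–Hodge class map from the
`(1,0) ⊕ (0,1)` cotangent automorphic forms into the pin's `H¹_{B,τ'}(A_∞, ℂ)` (`StubT2MatsushimaHodgeAt`).
[cite: BorelWallach2000, VII 3.2, VII 3.6, XIII 1.2] [cite: VoisinHodgeI2002, Cor. 7.6] [cite: Borel1997, §5.14] 
v2.2 (registrar A-plan1 (g17), director s347 BY-NAME FOLD, 2026-08-30T22:37Z): CLOSED by ★ p792532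
`Theorems/H413MatsushimaHodgeClassMap.lean` :: `…Cruxes.H413.MatsushimaHodge.t2_matsushimaHodgeAt` (A-p19 (g15); the T2 node composed
over the three ★ closers T2a `CuspCot.t2a_holClassMapAt` p790124 · T2b `TowerConj.towerConjugationAt_pin` p791878 · T2c
`P4StubT2cCohClassMapOfHol.stubT2cCohClassMapOfHol_holds` p791720; type = this stub's body verbatim) — no `sorry` here any more;
the registered sub-line `Lines/F0_P4AdmissibleOccursInH1.lean` ed. 1.4 carries the same closure as `stubT2MatsushimaHodgeAt_holds`. -/
theorem stub_T2_matsushimaHodgeAt : StubT2MatsushimaHodgeAt :=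
  Summit.HodgeConjecture.HodgeConjecture.Cruxes.H413.MatsushimaHodge.t2_matsushimaHodgeAt

/-- **`stub_T3_thetaFormsAt`** — REGISTERED STUB T3 (L–XL): the global theta lift of `χ` gives a non-zero equivariant map from `ω_V(t)` into the
cohomological cotangent automorphic forms, for weight-one admissible `t` (`StubT3ThetaFormsAt`). [cite: Liu2021, proof of Prop. 4.13, l. 2145; Lem. D.2]
[cite: GelbartRogawski1991, §3 Prop. 3.1.1] [cite: Weil1964, n° 41 Thm. 6] [cite: Li1992, Thm. 2.1] [cite: KonnoKonno2007, Thm. 5.4] -/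
theorem stub_T3_thetaFormsAt : StubT3ThetaFormsAt := by
  sorry

/-! ## §4 Kernel-checked composition (no proof hole below this line) -/

section Assembly

variable {F₀ E₀ : Type} [Field F₀] [NumberField F₀] [IsTotallyReal F₀] [Field E₀] [NumberField E₀] [Algebra F₀ E₀]
  [IsTotallyComplex E₀] [Algebra.IsQuadraticExtension F₀ E₀]

/-- **The algebra of the assembly** (generic, any `Prop413Data`): an INJECTIVE `G`-equivariant `ℂ`-linear map `cls : A → H¹_B` on a
`G`-stable target subspace `A` of some `G`-module of functions, composed with a NON-ZERO `G`-equivariant map `θ : ω_t → A`, is a non-zero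
intertwiner `ω_t → H¹_B`, i.e. `ω_t` OCCURS (`OccursInH1`). [cite: Liu2021, proof of Prop. 4.13, l. 2145] -/
theorem occursInH1_of_classMap_of_thetaForms (P : Prop413Data F₀ E₀) (τ' : E₀ →+* ℂ) (t : P.Triple)
    {X : Type} [AddCommGroup X] [Module ℂ X] (R : Representation ℂ P.G X) (A : Submodule ℂ X)
    (cls : ↥A →ₗ[ℂ] P.HB τ') (hinj : Function.Injective cls)
    (hcls : ∀ (g : P.G) (f : ↥A) (hgf : R g (f : X) ∈ A), cls ⟨R g (f : X), hgf⟩ = P.rhoB τ' g (cls f))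
    (θ : P.omega t.μ t.isConjugateSymplectic t.ε t.χ →ₗ[ℂ] X) (hθ : θ ≠ 0) (hθA : ∀ v, θ v ∈ A)
    (hθeq : ∀ (g : P.G) (v : P.omega t.μ t.isConjugateSymplectic t.ε t.χ), θ (rhoTriple P t g v) = R g (θ v)) :
    OccursInH1 P τ' (rhoTriple P t) := by
  -- the composite `v ↦ cls ⟨θ v, _⟩`
  let j : P.omega t.μ t.isConjugateSymplectic t.ε t.χ →ₗ[ℂ] P.HB τ' := cls ∘ₗ LinearMap.codRestrict A θ hθA
  have hj : ∀ (g : P.G) (v : P.omega t.μ t.isConjugateSymplectic t.ε t.χ), j (rhoTriple P t g v) = P.rhoB τ' g (j v) := by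
    intro g v
    have hmem : R g (θ v) ∈ A := by rw [← hθeq]; exact hθA _
    have h1 : LinearMap.codRestrict A θ hθA (rhoTriple P t g v) = ⟨R g (θ v), hmem⟩ := by
      apply Subtype.ext
      simp only [LinearMap.codRestrict_apply, hθeq]
    have h2 := hcls g ⟨θ v, hθA v⟩ hmem
    calc j (rhoTriple P t g v) = cls (LinearMap.codRestrict A θ hθA (rhoTriple P t g v)) := rfl
      _ = cls ⟨R g (θ v), hmem⟩ := by rw [h1]
      _ = P.rhoB τ' g (cls ⟨θ v, hθA v⟩) := h2
      _ = P.rhoB τ' g (j v) := rfl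
  refine ⟨LinearMap.intertwiningMap_of_isIntertwiningMap (ρ := rhoTriple P t) (σ := P.rhoB τ') j hj, ?_⟩
  -- non-vanishing: `θ v ≠ 0` for some `v`, and `cls` is injective
  obtain ⟨v, hv⟩ : ∃ v, θ v ≠ 0 :=
    Classical.by_contradiction fun h => hθ (LinearMap.ext fun w => not_ne_iff.mp (not_exists.mp h w))
  intro hzero
  have hjv : j v = 0 := by
    have := congrArg (fun φ : Representation.IntertwiningMap (rhoTriple P t) (P.rhoB τ') => φ v) hzero
    simpa using this
  have : LinearMap.codRestrict A θ hθA v = 0 := hinj (by simpa [j] using hjv)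
  exact hv (by simpa using congrArg Subtype.val this)

end Assembly

set_option synthInstance.maxHeartbeats 400000 in
set_option maxHeartbeats 8000000 in
/-- **HEAD 1 — `hocc` from the two stubs** (kernel-checked): `StubT2 → StubT3 → HoccType`.  Unfold `HoccType` to the face, take the class map
at the factor of record (T2′, `3 ≤ n` from `n = 3`) and the theta map (T3′), and apply `occursInH1_of_classMap_of_thetaForms`. HC_CM is proved only modulo the 7 printed citations until rung 0 closes.
[cite: Liu2021, proof of Prop. 4.13, l. 2145] -/
theorem admissible_occursInH1_holds_of (h2 : StubT2MatsushimaHodgeAt) (h3 : StubT3ThetaFormsAt) : HoccType := by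
  intro hDel F _ h6 ι₁ V a₀ Φ hΦ i hn τ' t hw hadm
  obtain ⟨cls, hinj, hcls⟩ := h2 hDel F h6 V a₀ Φ hΦ i (le_of_eq hn.symm) τ'
  obtain ⟨θ, hθ, hθA, hθeq⟩ := h3 hDel F h6 V a₀ Φ hΦ i hn t hw hadm
  exact occursInH1_of_classMap_of_thetaForms (datum413 hDel F V a₀ Φ i) τ' t (rightRep F V) (cohForms (archFactorOf F V)) cls hinj hcls
    θ hθ hθA hθeq

set_option synthInstance.maxHeartbeats 400000 in
set_option maxHeartbeats 8000000 in
/-- **`hocc` MODULO EXACTLY THE TWO P4 STUBS** (zero further hypotheses): HEAD 1 applied to `stub_T2_matsushimaHodgeAt`, `stub_T3_thetaFormsAt` —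
the by-name fold `stub_admissible_occursInH1 := hocc_of_stubs` of `Cruxes/H413/Lines/a3_liu413.lean` (socket board, A-SIDE
MAP c7c22efe) once the two stubs are theorems.  HC_CM is proved only modulo the 7 printed citations until rung 0 closes.
[cite: Liu2021, proof of Prop. 4.13, l. 2145] -/
theorem hocc_of_stubs : HoccType :=
  admissible_occursInH1_holds_of stub_T2_matsushimaHodgeAt stub_T3_thetaFormsAt

set_option synthInstance.maxHeartbeats 400000 in
set_option maxHeartbeats 8000000 in
/-- **HEAD 2 (head of record, A-plan1 (g17) 19:12:10Z ruling) — the crux `HCCMUnconditional.H413` BY NAME from the two P4 stubs and the two OTHER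
floor rows as hypotheses**: `StubT2 → StubT3 → HdictEType → HJ3aType → H413` := ★ `Hyp413Closing.H413_of_three_facts_flat hdictE hJ3a
(admissible_occursInH1_holds_of h2 h3)`.  `hdictE` (III-2 (a)′) and `hJ3a` (III-J3a) are programmes P2 ∕ P3's letters, registered as stubs of
`Cruxes/H413/Lines/a3_liu413.lean` v10.2 (:271 ∕ :300) — NOT re-declared here (no duplicate obligations); under `#h21_check_skeleton` this head reads
`skeleton.extra-hypothesis` BY DESIGN (registration semantics of the F0 lines = tomorrow's keyed F0P4 planner on gate10's answer, director s320 (3) ∕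
s321 (D2)).  HC_CM is proved only modulo the 7 printed citations until rung 0 closes. [cite: Liu2021, Prop. 4.13; Rem. 4.14] -/
theorem H413_of_P4 (h2 : StubT2MatsushimaHodgeAt) (h3 : StubT3ThetaFormsAt) (hdictE : HdictEType) (hJ3a : HJ3aType) :
    Summit.HodgeConjecture.HodgeConjecture.Theses.HCCMUnconditional.H413 :=
  Summit.HodgeConjecture.CorCM.Hyp413Closing.H413_of_three_facts_flat hdictE hJ3a (admissible_occursInH1_holds_of h2 h3)

end Summit.HodgeConjecture.HodgeConjecture.Cruxes.H413.P4AdmissibleOccursInH1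


end
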